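/-
Origin: expansion seat `planner-pub-hodgecm-pohl-g13-0`, handover #2 2026-08-18T13:12:02Z (md5 b7394864dfd86d98d31e8da81e2c4dfb, 358 l.; RUN 30 additive leaf; lands AFTER my #1 HodgeCM/Proofs/Pohlmann/GaloisSpanCriterion.lean (97cc3dc4); rewrite import Pohl13.GaloisSpanCriterion -> HodgeCM.Proofs.Pohlmann.GaloisSpanCriterion x1) (`HOME/pub-hodgecm-pohl-g13/lean/Pohl13/GaloisSpanAntiSpace.lean`, md5 b7394864, 358 lines);
landed by the gen-8 packager in gate run 30 as `HodgeCM/Proofs/Pohlmann/GaloisSpanAntiSpace.lean` (import ^import Pohl13\.GaloisSpanCriterion[ \t]*$→import HodgeCM.Proofs.Pohlmann.GaloisSpanCriterion ×1).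
-/
/-
Copyright: pub-hodgecm formalisation cell (harness21, 2026). New file (not vendored).
Origin: HOME/pub-hodgecm-pohl-g13/lean/Pohl13/GaloisSpanAntiSpace.lean — session planner-pub-hodgecm-pohl-g13-0 (unit pub-hodgecm-pohl-g13),
EXPANSION part (b) `PohlmannSpan`, generation 13, file 2.  Intended final place: `HodgeCM/Proofs/Pohlmann/GaloisSpanAntiSpace.lean`
(module `HodgeCM.Proofs.Pohlmann.GaloisSpanAntiSpace`).  ADDITIVE leaf.  WIP import `Pohl13.GaloisSpanCriterion` = this seat's file 1
`HodgeCM/Proofs/Pohlmann/GaloisSpanCriterion.lean` (rewrite to `import HodgeCM.Proofs.Pohlmann.GaloisSpanCriterion` on landing).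
-/
import Summits.HodgeConjecture.HodgeCM.Proofs.Pohlmann.GaloisSpanCriterion

/-!
# The Galois span condition as a spanning condition: `LIN(F)` iff the `a_σ` span the whole anti-space

`GaloisSpanCriterion.lean` (file 1) decides when the naive Pohlmann span holds for all families of CM types of a CM field `F`: iff
the GALOIS SPAN CONDITION `NonGalois.GalSpanCondition F n` — every Galois translate `P ∈ GalT F` has its antisymmetrised graph `a_P`
in `galAntiSpan F n = span_ℚ {a_σ : σ ∈ Gal(E^c/ℚ)}`.  This file makes the condition a pure SPANNING (dimension-type) condition in
the generic non-Galois situation `Aut(F/ℚ) = {1, c}` (`NonGalois.AutPair F`, gen 9), and records the first kernel instances.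

* `NonGalois.exists_galF_apply_eq` — `Gal(E^c/ℚ)` acts TRANSITIVELY on `Hom(F, ℂ)` (`IsAlgClosed.lift` + `GaoUllmo.autOfEmb`).
* `NonGalois.IsBarCommuting`, `isGalTranslate_iff_isBarCommuting` — under `AutPair F` the Galois translates are exactly the
  permutations of `Hom(F, ℂ)` commuting with complex conjugation (in general they are among them, `isBarCommuting_galT`).
* `NonGalois.antiSpace F` — the functions `f` on `Hom(F,ℂ) × Hom(F,ℂ)` odd under conjugation in each variable
  (`f(s, x̄) = −f(s, x) = f(s̄, x)`); it contains `a_g` for every conjugation-commuting `g` (`antiInd_mem_antiSpace`), in particular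
  `galAntiSpan F n ≤ antiSpace F` (`F` CM) and every `a_P`, `P ∈ GalT F`; it is spanned by the ELEMENTARY anti-functions
  `elemAnti s₀ x₀ (s, x) = c_{s₀}(s) c_{x₀}(x)`, `c_y(x) = [y = x] − [ȳ = x]` (`four_smul_eq_sum_elemAnti`: `4f = Σ_q f(q) e_q`).
* THE SWAP IDENTITY `antiInd_sub_antiInd_swap`: for an injective conjugation-commuting `g` with `g s₀ = x₀`,
  `a_g − a_{τ ∘ g} = 2 e_{s₀ x₀}` where `τ` is the transposition `x₀ ↔ x̄₀`.
* **THEOREM** `NonGalois.galSpanCondition_iff_antiSpace_le` (`F` CM, `AutPair F`):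
  `GalSpanCondition F n ↔ antiSpace F ≤ galAntiSpan F n` (`↔ galAntiSpan F n = antiSpace F`,
  `galSpanCondition_iff_galAntiSpan_eq`) — i.e. LIN(F) holds iff the antisymmetrised graphs `a_σ` of the Galois group SPAN the whole
  anti-space.  (⇐ holds for every CM field, `galSpanCondition_of_antiSpace_le`; ⇒ uses transitivity, the swap identity and the
  Galois translates `swapT` of gen 9.)  With file 1 and pohl-g12: `Universe.forall_naivePohlmannSpanAt_iff_antiSpace_le` — under the
  model axioms and N1–N3, for a CM field with `Aut(F/ℚ) = {1, c}` the naive Pohlmann span holds for all families of CM types iff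
  `antiSpace F ≤ galAntiSpan F 0`.
* INSTANCES: `not_galSpanCondition_of_not_indexSetsAgree`, `not_galSpanCondition_of_autPair` (a Galois-stable type with two
  elements refutes LIN), `Universe.not_galSpanCondition_K₂` (pohl-g11's sextic `K₂` violates LIN at every level); the positive
  instances `galSpanCondition_of_isGalois` / `_of_galTOf_surjective` are in file 1.

Nothing is posited; nothing is cited; pure linear algebra and Galois theory over tree files.
-/

noncomputable section

open scoped TensorProduct NumberField BigOperators
open NumberField NumberField.ComplexEmbedding

attribute [local instance] Classical.propDecidable

namespace HodgeCM

open Literature.AlgebraicGeometry.Motives (CMType HodgeStructure)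
open HodgeCM.Pohlmann HodgeCM.GaoUllmo HodgeCM.CMTypeOps

namespace NonGalois

/-! ### Transitivity of `Gal(E^c/ℚ)` on `Hom(F, ℂ)` -/

section Transitive

variable {F : Type} [Field F] [NumberField F] {n : ℕ}

/-- `Gal(E^c/ℚ)` (`E = F^{n+1}`) acts TRANSITIVELY on `Hom(F, ℂ)`: extend `x₀ ∘ s₀⁻¹ : s₀(F) → ℂ` to `E^c` (`IsAlgClosed.lift`)
and turn the extension into an automorphism (`autOfEmb`). -/
theorem exists_galF_apply_eq (s₀ x₀ : F →+* ℂ) :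
    ∃ σ : galoisClosure (Fin (n + 1) → F) ≃ₐ[ℚ] galoisClosure (Fin (n + 1) → F), galF n σ s₀ = x₀ := by
  let j₀ : F →+* galoisClosure (Fin (n + 1) → F) :=
    (corestrict (Fin (n + 1) → F) (piEmb 0 s₀) : (Fin (n + 1) → F) →+* galoisClosure (Fin (n + 1) → F)).comp piDiag
  letI : Algebra F (galoisClosure (Fin (n + 1) → F)) := j₀.toAlgebra
  letI : Algebra F ℂ := x₀.toAlgebra
  haveI : IsScalarTower ℚ F (galoisClosure (Fin (n + 1) → F)) := IsScalarTower.of_algebraMap_eq' (Subsingleton.elim _ _)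
  haveI : Algebra.IsAlgebraic F (galoisClosure (Fin (n + 1) → F)) := Algebra.IsAlgebraic.tower_top (K := ℚ) F
  let ρ₀ : galoisClosure (Fin (n + 1) → F) →ₐ[F] ℂ := IsAlgClosed.lift
  refine ⟨autOfEmb ρ₀.toRingHom.toRatAlgHom, RingHom.ext fun a => ?_⟩
  rw [galF_autOfEmb_apply]
  show ρ₀ (algebraMap F _ a) = algebraMap F ℂ a
  exact ρ₀.commutes a

end Transitive

/-! ### Negative instances of the Galois span condition -/

section Negative

variable {F : Type} [Field F] [NumberField F]

/-- One disagreement of the index sets (at any level `m`) refutes the Galois span condition (at every level `n`). -/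
theorem not_galSpanCondition_of_not_indexSetsAgree {m : ℕ} {Θ : Fin (m + 1) → CMType F} {p : ℕ} (h : ¬ IndexSetsAgree Θ p)
    (n : ℕ) : ¬ GalSpanCondition F n :=
  fun hG => h (indexSetsAgree_of_galSpanCondition ((galSpanCondition_iff n m).mp hG) Θ p)

/-- `Aut(F/ℚ) = {1, c}` together with a Galois-stable CM type with two distinct elements refutes the Galois span condition
(pohl-g12's `not_indexSetsAgree_of_autPair`). -/
theorem not_galSpanCondition_of_autPair [IsCMField F] (hA : AutPair F) (Θ : CMType F) (hΘ : GalStableType Θ)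
    (h2 : ∃ s₁ ∈ Θ.1, ∃ s₂ ∈ Θ.1, s₁ ≠ s₂) (n : ℕ) : ¬ GalSpanCondition F n :=
  not_galSpanCondition_of_not_indexSetsAgree (not_indexSetsAgree_of_autPair hA Θ hΘ h2) n

end Negative

/-! ### Galois translates and conjugation-commuting permutations -/

section Bar

variable {F : Type} [Field F] [NumberField F] {n : ℕ}

/-- A self-map of `Hom(F, ℂ)` commuting with complex conjugation. -/
def IsBarCommuting (g : (F →+* ℂ) → (F →+* ℂ)) : Prop :=
  ∀ s, g (conjugate s) = conjugate (g s)

variable [IsCMField F]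

/-- Every Galois translate of a CM field commutes with conjugation (`GalT.apply_conjugate`). -/
theorem isBarCommuting_galT (P : GalT F) : IsBarCommuting P.1 := fun s => GalT.apply_conjugate P s

/-- (Ported verbatim from the HodgeCMPerL package; no docstring in the source.) -/
theorem isBarCommuting_galF (σ : galoisClosure (Fin (n + 1) → F) ≃ₐ[ℚ] galoisClosure (Fin (n + 1) → F)) :
    IsBarCommuting (galF n σ) := fun s => GalT.apply_conjugate (galTOf σ) s

/-- Under `Aut(F/ℚ) = {1, c}` every conjugation-commuting permutation IS a Galois translate. -/
theorem isGalTranslate_of_isBarCommuting (hA : AutPair F) {P : Equiv.Perm (F →+* ℂ)} (hP : IsBarCommuting P) :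
    IsGalTranslate F P := by
  intro σ g
  rcases hA g with rfl | rfl
  · show P (σ.comp (RingHom.id F)) = (P σ).comp (RingHom.id F)
    rw [RingHom.comp_id, RingHom.comp_id]
  · rw [← conjugate_eq_comp_conjAlgEquiv, ← conjugate_eq_comp_conjAlgEquiv]
    exact hP σ

/-- (Ported verbatim from the HodgeCMPerL package; no docstring in the source.) -/
theorem isGalTranslate_iff_isBarCommuting (hA : AutPair F) (P : Equiv.Perm (F →+* ℂ)) :
    IsGalTranslate F P ↔ IsBarCommuting P :=
  ⟨fun h => isBarCommuting_galT ⟨P, h⟩, isGalTranslate_of_isBarCommuting hA⟩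

/-- Hence under `Aut(F/ℚ) = {1, c}` the Galois span condition quantifies over the conjugation-commuting permutations. -/
theorem galSpanCondition_iff_forall_isBarCommuting (hA : AutPair F) :
    GalSpanCondition F n ↔ ∀ P : Equiv.Perm (F →+* ℂ), IsBarCommuting P → antiInd P ∈ galAntiSpan F n :=
  ⟨fun h P hP => h ⟨P, isGalTranslate_of_isBarCommuting hA hP⟩, fun h P => h P.1 (isBarCommuting_galT P)⟩

end Bar

/-! ### The anti-space and its elementary functions -/

section Anti

variable {F : Type} [Field F]

/-- `c_y(x) = [y = x] − [ȳ = x]` (so that `a_g(s, x) = c_{g s}(x)`). -/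
def sgnAt (y x : F →+* ℂ) : ℚ :=
  (if y = x then 1 else 0) - (if conjugate y = x then 1 else 0)

/-- (Ported verbatim from the HodgeCMPerL package; no docstring in the source.) -/
theorem antiInd_eq_sgnAt (g : (F →+* ℂ) → (F →+* ℂ)) (s x : F →+* ℂ) : antiInd g (s, x) = sgnAt (g s) x := rfl

/-- (Ported verbatim from the HodgeCMPerL package; no docstring in the source.) -/
theorem sgnAt_eq' (y x : F →+* ℂ) : sgnAt y x = (if y = x then 1 else 0) - (if y = conjugate x then 1 else 0) := by
  unfold sgnAt
  have h : (conjugate y = x) ↔ (y = conjugate x) :=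
    ⟨fun h => by rw [← h, involutive_conjugate], fun h => by rw [h, involutive_conjugate]⟩
  simp only [h]

/-- (Ported verbatim from the HodgeCMPerL package; no docstring in the source.) -/
theorem sgnAt_conjugate_right (y x : F →+* ℂ) : sgnAt y (conjugate x) = -sgnAt y x := by
  rw [sgnAt_eq' y (conjugate x), sgnAt_eq' y x, (involutive_conjugate F) x]
  ring

/-- (Ported verbatim from the HodgeCMPerL package; no docstring in the source.) -/
theorem sgnAt_conjugate_left (y x : F →+* ℂ) : sgnAt (conjugate y) x = -sgnAt y x := by
  rw [sgnAt, sgnAt, (involutive_conjugate F) y]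
  ring

/-- (Ported verbatim from the HodgeCMPerL package; no docstring in the source.) -/
theorem sgnAt_self [IsTotallyComplex F] (y : F →+* ℂ) : sgnAt y y = 1 := by
  rw [sgnAt, if_pos rfl, if_neg (conjugate_ne y), sub_zero]

/-- (Ported verbatim from the HodgeCMPerL package; no docstring in the source.) -/
theorem sgnAt_of_ne_of_ne {y x : F →+* ℂ} (h1 : y ≠ x) (h2 : conjugate y ≠ x) : sgnAt y x = 0 := by
  rw [sgnAt, if_neg h1, if_neg h2, sub_zero]

variable (F) in
/-- **The anti-space**: functions on `Hom(F,ℂ) × Hom(F,ℂ)` odd under conjugation in each variable. -/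
def antiSpace : Submodule ℚ ((F →+* ℂ) × (F →+* ℂ) → ℚ) where
  carrier := {f | ∀ s x, f (s, conjugate x) = -f (s, x) ∧ f (conjugate s, x) = -f (s, x)}
  add_mem' := by
    intro f g hf hg s x
    simp only [Pi.add_apply]
    rw [(hf s x).1, (hg s x).1, (hf s x).2, (hg s x).2]
    constructor <;> ring
  zero_mem' := by
    intro s x
    simp
  smul_mem' := by
    intro c f hf s x
    simp only [Pi.smul_apply, smul_eq_mul]
    rw [(hf s x).1, (hf s x).2]
    constructor <;> ring

/-- (Ported verbatim from the HodgeCMPerL package; no docstring in the source.) -/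
theorem mem_antiSpace {f : (F →+* ℂ) × (F →+* ℂ) → ℚ} :
    f ∈ antiSpace F ↔ ∀ s x, f (s, conjugate x) = -f (s, x) ∧ f (conjugate s, x) = -f (s, x) :=
  Iff.rfl

/-- `a_g` is in the anti-space for every conjugation-commuting `g`. -/
theorem antiInd_mem_antiSpace {g : (F →+* ℂ) → (F →+* ℂ)} (hg : IsBarCommuting g) : antiInd g ∈ antiSpace F := by
  intro s x
  rw [antiInd_eq_sgnAt, antiInd_eq_sgnAt, antiInd_eq_sgnAt, hg s, sgnAt_conjugate_right, sgnAt_conjugate_left]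
  exact ⟨rfl, rfl⟩

/-- The **elementary anti-function** `e_{s₀ x₀}(s, x) = c_{s₀}(s) · c_{x₀}(x)`. -/
def elemAnti (s₀ x₀ : F →+* ℂ) : (F →+* ℂ) × (F →+* ℂ) → ℚ :=
  fun q => sgnAt s₀ q.1 * sgnAt x₀ q.2

/-- (Ported verbatim from the HodgeCMPerL package; no docstring in the source.) -/
theorem elemAnti_apply (s₀ x₀ s x : F →+* ℂ) : elemAnti s₀ x₀ (s, x) = sgnAt s₀ s * sgnAt x₀ x := rfl

/-- (Ported verbatim from the HodgeCMPerL package; no docstring in the source.) -/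
theorem elemAnti_mem_antiSpace (s₀ x₀ : F →+* ℂ) : elemAnti s₀ x₀ ∈ antiSpace F := by
  intro s x
  rw [elemAnti_apply, elemAnti_apply, elemAnti_apply, sgnAt_conjugate_right, sgnAt_conjugate_right]
  constructor <;> ring

/-- **The swap identity.**  For an injective conjugation-commuting `g` with `g s₀ = x₀` and the transposition `τ = (x₀ x̄₀)`:
`a_g − a_{τ ∘ g} = 2 e_{s₀ x₀}`. -/
theorem antiInd_sub_antiInd_swap [IsTotallyComplex F] {g : (F →+* ℂ) → (F →+* ℂ)} (hg : IsBarCommuting g)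
    (hinj : Function.Injective g) {s₀ x₀ : F →+* ℂ} (h0 : g s₀ = x₀) :
    antiInd g - antiInd (fun s => Equiv.swap x₀ (conjugate x₀) (g s)) = (2 : ℚ) • elemAnti s₀ x₀ := by
  funext q
  obtain ⟨s, x⟩ := q
  rw [Pi.sub_apply, Pi.smul_apply, smul_eq_mul, antiInd_eq_sgnAt, antiInd_eq_sgnAt, elemAnti_apply]
  have hx₀ : conjugate x₀ ≠ x₀ := conjugate_ne x₀
  by_cases h1 : s = s₀
  · subst h1
    rw [h0, Equiv.swap_apply_left, sgnAt_conjugate_left, sgnAt_self]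
    ring
  by_cases h2 : s = conjugate s₀
  · subst h2
    rw [hg s₀, h0, Equiv.swap_apply_right, sgnAt_conjugate_left, sgnAt_conjugate_right, sgnAt_self]
    ring
  · have h3 : g s ≠ x₀ := fun h => h1 (hinj (h.trans h0.symm))
    have h4 : g s ≠ conjugate x₀ := fun h => h2 (hinj (by rw [h, hg s₀, h0]))
    have h5 : s₀ ≠ s := fun h => h1 h.symm
    have h6 : conjugate s₀ ≠ s := fun h => h2 h.symm
    rw [Equiv.swap_apply_of_ne_of_ne h3 h4, sgnAt_of_ne_of_ne h5 h6]
    ring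

variable [NumberField F]

/-- `Σ_y w(y) c_y(x) = w(x) − w(x̄)`. -/
theorem sum_mul_sgnAt (w : (F →+* ℂ) → ℚ) (x : F →+* ℂ) : ∑ y, w y * sgnAt y x = w x - w (conjugate x) := by
  simp only [sgnAt_eq', mul_sub, mul_ite, mul_one, mul_zero, Finset.sum_sub_distrib]
  rw [Finset.sum_ite_eq' Finset.univ x, Finset.sum_ite_eq' Finset.univ (conjugate x)]
  simp only [Finset.mem_univ, if_true]

/-- **The elementary anti-functions span the anti-space**: `4 f = Σ_q f(q) e_q` for `f` in the anti-space. -/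
theorem four_smul_eq_sum_elemAnti {f : (F →+* ℂ) × (F →+* ℂ) → ℚ} (hf : f ∈ antiSpace F) :
    (4 : ℚ) • f = ∑ q : (F →+* ℂ) × (F →+* ℂ), f q • elemAnti q.1 q.2 := by
  funext q
  obtain ⟨s, x⟩ := q
  rw [Pi.smul_apply, Finset.sum_apply, smul_eq_mul]
  simp only [Pi.smul_apply, smul_eq_mul, elemAnti_apply]
  calc (4 : ℚ) * f (s, x)
      = ∑ s₀, f (s₀, x) * (2 * sgnAt s₀ s) := by
        have h2 : ∀ s₀, f (s₀, x) * (2 * sgnAt s₀ s) = (fun s₀ => 2 * f (s₀, x)) s₀ * sgnAt s₀ s := fun s₀ => by ring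
        simp only [h2]
        rw [sum_mul_sgnAt (fun s₀ => 2 * f (s₀, x)) s, (hf s x).2]
        ring
    _ = ∑ s₀, ∑ x₀, f (s₀, x₀) * (sgnAt s₀ s * sgnAt x₀ x) := by
        refine Finset.sum_congr rfl fun s₀ _ => ?_
        have h3 : ∀ x₀, f (s₀, x₀) * (sgnAt s₀ s * sgnAt x₀ x) = sgnAt s₀ s * (f (s₀, x₀) * sgnAt x₀ x) := fun x₀ => by ring
        simp only [h3]
        rw [← Finset.mul_sum, sum_mul_sgnAt (fun x₀ => f (s₀, x₀)) x, (hf s₀ x).1]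
        ring
    _ = ∑ q : (F →+* ℂ) × (F →+* ℂ), f q * (sgnAt q.1 s * sgnAt q.2 x) :=
        (Fintype.sum_prod_type fun q : (F →+* ℂ) × (F →+* ℂ) => f q * (sgnAt q.1 s * sgnAt q.2 x)).symm

/-- Hence the anti-space is the span of the elementary anti-functions. -/
theorem mem_span_elemAnti {f : (F →+* ℂ) × (F →+* ℂ) → ℚ} (hf : f ∈ antiSpace F) :
    f ∈ Submodule.span ℚ (Set.range fun q : (F →+* ℂ) × (F →+* ℂ) => elemAnti q.1 q.2) := by
  have h : f = (4 : ℚ)⁻¹ • ∑ q : (F →+* ℂ) × (F →+* ℂ), f q • elemAnti q.1 q.2 := by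
    rw [← four_smul_eq_sum_elemAnti hf, smul_smul]
    norm_num
  rw [h]
  exact Submodule.smul_mem _ _ (Submodule.sum_mem _ fun q _ => Submodule.smul_mem _ _ (Submodule.subset_span ⟨q, rfl⟩))

/-- (Ported verbatim from the HodgeCMPerL package; no docstring in the source.) -/
theorem antiSpace_eq_span_elemAnti :
    antiSpace F = Submodule.span ℚ (Set.range fun q : (F →+* ℂ) × (F →+* ℂ) => elemAnti q.1 q.2) :=
  le_antisymm (fun _ hf => mem_span_elemAnti hf)
    (Submodule.span_le.mpr (by rintro _ ⟨q, rfl⟩; exact elemAnti_mem_antiSpace q.1 q.2))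

end Anti

/-! ### The theorem: LIN(F) iff the `a_σ` span the anti-space -/

section Main

variable {F : Type} [Field F] [NumberField F] [IsCMField F] {n : ℕ}

/-- (Ported verbatim from the HodgeCMPerL package; no docstring in the source.) -/
theorem galAntiSpan_le_antiSpace : galAntiSpan F n ≤ antiSpace F :=
  Submodule.span_le.mpr (by
    rintro _ ⟨σ, rfl⟩
    exact antiInd_mem_antiSpace (isBarCommuting_galF σ))

/-- (Ported verbatim from the HodgeCMPerL package; no docstring in the source.) -/
theorem antiInd_galT_mem_antiSpace (P : GalT F) : antiInd P.1 ∈ antiSpace F :=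
  antiInd_mem_antiSpace (isBarCommuting_galT P)

/-- (⇐, every CM field) If the `a_σ` span the anti-space, the Galois span condition holds. -/
theorem galSpanCondition_of_antiSpace_le (h : antiSpace F ≤ galAntiSpan F n) : GalSpanCondition F n :=
  fun P => h (antiInd_galT_mem_antiSpace P)

/-- (⇒, `Aut(F/ℚ) = {1, c}`) Under the Galois span condition every elementary anti-function lies in the Galois span:
`2 e_{s₀ x₀} = a_σ − a_{τ·σ}` with `σ s₀ = x₀` (transitivity) and `τ = swapT x₀ ∈ GalT F`. -/
theorem elemAnti_mem_galAntiSpan (hA : AutPair F) (h : GalSpanCondition F n) (s₀ x₀ : F →+* ℂ) :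
    elemAnti s₀ x₀ ∈ galAntiSpan F n := by
  obtain ⟨σ, hσ⟩ := exists_galF_apply_eq (n := n) s₀ x₀
  have h1 : antiInd (galF n σ) ∈ galAntiSpan F n := antiInd_galF_mem_galAntiSpan σ
  have h2 : antiInd (fun s => Equiv.swap x₀ (conjugate x₀) (galF n σ s)) ∈ galAntiSpan F n := h (swapT hA x₀ * galTOf σ)
  have key := antiInd_sub_antiInd_swap (isBarCommuting_galF σ) (galF_injective σ) hσ
  have h3 : elemAnti s₀ x₀ = (2 : ℚ)⁻¹ • (antiInd (galF n σ) - antiInd (fun s => Equiv.swap x₀ (conjugate x₀) (galF n σ s))) := by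
    rw [key, smul_smul]
    norm_num
  rw [h3]
  exact Submodule.smul_mem _ _ (Submodule.sub_mem _ h1 h2)

/-- (Ported verbatim from the HodgeCMPerL package; no docstring in the source.) -/
theorem antiSpace_le_galAntiSpan (hA : AutPair F) (h : GalSpanCondition F n) : antiSpace F ≤ galAntiSpan F n := by
  intro f hf
  refine (Submodule.span_le.mpr ?_) (mem_span_elemAnti hf)
  rintro _ ⟨q, rfl⟩
  exact elemAnti_mem_galAntiSpan hA h q.1 q.2

/-- **THEOREM.**  For a CM field with `Aut(F/ℚ) = {1, c}`: the Galois span condition holds iff the antisymmetrised graphs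
`a_σ`, `σ ∈ Gal(E^c/ℚ)`, span the whole anti-space. -/
theorem galSpanCondition_iff_antiSpace_le (hA : AutPair F) : GalSpanCondition F n ↔ antiSpace F ≤ galAntiSpan F n :=
  ⟨antiSpace_le_galAntiSpan hA, galSpanCondition_of_antiSpace_le⟩

/-- (Ported verbatim from the HodgeCMPerL package; no docstring in the source.) -/
theorem galSpanCondition_iff_galAntiSpan_eq (hA : AutPair F) : GalSpanCondition F n ↔ galAntiSpan F n = antiSpace F :=
  ⟨fun h => le_antisymm galAntiSpan_le_antiSpace (antiSpace_le_galAntiSpan hA h), fun h => galSpanCondition_of_antiSpace_le h.ge⟩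

/-- … equivalently, iff every elementary anti-function `e_{s₀ x₀}` is a `ℚ`-combination of the `a_σ`. -/
theorem galSpanCondition_iff_forall_elemAnti_mem (hA : AutPair F) :
    GalSpanCondition F n ↔ ∀ s₀ x₀ : F →+* ℂ, elemAnti s₀ x₀ ∈ galAntiSpan F n :=
  ⟨fun h => elemAnti_mem_galAntiSpan hA h, fun h =>
    galSpanCondition_of_antiSpace_le (by
      rw [antiSpace_eq_span_elemAnti, Submodule.span_le]
      rintro _ ⟨q, rfl⟩
      exact h q.1 q.2)⟩

end Main

end NonGalois

/-! ### Universe-level corollaries and the sextic instance -/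

namespace Universe

open NonGalois SexticCM

variable {U : Universe}

/-- Under the model axioms and N1–N3, for a CM field with `Aut(F/ℚ) = {1, c}`: the naive Pohlmann span holds at every `(n, Θ, p)`
iff the `a_σ` span the anti-space. -/
theorem forall_naivePohlmannSpanAt_iff_antiSpace_le (M : U.ModelAxioms) (hN1 : U.Fact_cupExterior) (hN2 : U.Fact_cup_hodge)
    (hN3 : U.Fact_pull_H0) (F : CMField) (hA : AutPair F) :
    (∀ (n : ℕ) (Θ : Fin (n + 1) → CMType F) (p : ℕ), U.NaivePohlmannSpanAt F Θ p) ↔ antiSpace F ≤ galAntiSpan F 0 := by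
  rw [forall_naivePohlmannSpanAt_iff_galSpanCondition M hN1 hN2 hN3 F, galSpanCondition_iff_antiSpace_le hA]

/-- pohl-g11's non-Galois sextic CM field `K₂` violates the Galois span condition at every level. -/
theorem not_galSpanCondition_K₂ (n : ℕ) : ¬ GalSpanCondition K₂CM n :=
  not_galSpanCondition_of_not_indexSetsAgree not_indexSetsAgree_K₂ n

end Universe

end HodgeCM
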